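import Literature.Topology.FourManifolds.FoldPushGluing
import HarnessLib

/-!
# Pushing a fold arc: the fold charts persist along the pushed arc

Topic `Literature/Topology/FourManifolds` (programme of the fact
`Literature.Topology.FourManifolds.exists_isSimplifiedBrokenLefschetzFibration`, Baykur–Saeki 2017, §2.1,
§3).  Sequel of `FoldPushGluing`: the pushed map `g_θ` (`FoldPush.pushedMap`) has, at every
point of the pushed fold arc (the axis points of the chart `φ`), a fold chart of the same
signature: near the axis `F_θ = T_θ ∘ F₀` (`FoldPushModel`), `T_θ` is a local diffeomorphism
(`FoldPushPlane`), the model `F₀` has a fold chart at every axis point (translation charts),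
and fold charts pass through target local diffeomorphisms and through the charts `(φ, ψ)`
(`exists_foldChartSig_of_hasFoldChartSig`).

* `hasFoldChartSig_foldSigMap_axis`, `HasFoldChartSig.comp_localDiffeo`;
* `FoldPush.exists_pushedMap_foldCharts`.

Everything is proved; no definitions, no named facts (D-0026).

## References

* R. İ. Baykur, O. Saeki, *Simplifying indefinite fibrations on 4-manifolds*, arXiv:1705.11169,
  §2.1 p. 6, §3. [BaykurSaeki2017]
* M. Golubitsky, V. Guillemin, *Stable Mappings and Their Singularities*, GTM 14 (1973), Ch. III
  §4. [GolubitskyGuillemin1973]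
-/

noncomputable section

set_option maxSynthPendingDepth 2

open Set Function Filter Module Metric
open scoped ContDiff Topology Manifold

namespace Literature.Topology.FourManifolds

/-- Local notation: `𝔼 n` is the model Euclidean space `EuclideanSpace ℝ (Fin n)`. -/
local notation "𝔼 " n:arg => EuclideanSpace ℝ (Fin n)

/-! ### The fold model has a fold chart at every axis point -/

/-- Translating along the axis: `F₀(z + t e₀) = F₀(z) + t e₀'`. [folklore] -/
theorem foldSigMap_add_smul_single (s₁ s₂ s₃ t : ℝ) (z : 𝔼 4) :
    foldSigMap s₁ s₂ s₃ (z + t • EuclideanSpace.single (0 : Fin 4) (1 : ℝ)) =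
      foldSigMap s₁ s₂ s₃ z + t • EuclideanSpace.single (0 : Fin 2) (1 : ℝ) := by
  ext i
  fin_cases i <;> simp

/-- **The fold model has a fold chart of its own signature at every axis point** (translation
charts). [cite: BaykurSaeki2017, §2.1] -/
theorem hasFoldChartSig_foldSigMap_axis (s₁ s₂ s₃ t : ℝ) :
    HasFoldChartSig (foldSigMap s₁ s₂ s₃) (t • EuclideanSpace.single (0 : Fin 4) (1 : ℝ))
      s₁ s₂ s₃ := by
  set y₀ : 𝔼 4 := t • EuclideanSpace.single (0 : Fin 4) (1 : ℝ) with hy₀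
  set w₀ : 𝔼 2 := t • EuclideanSpace.single (0 : Fin 2) (1 : ℝ) with hw₀
  set φ : OpenPartialHomeomorph (𝔼 4) (𝔼 4) := (Homeomorph.addRight (-y₀)).toOpenPartialHomeomorph
    with hφ
  set ψ : OpenPartialHomeomorph (𝔼 2) (𝔼 2) := (Homeomorph.addRight (-w₀)).toOpenPartialHomeomorph
    with hψ
  have hφa : (φ : 𝔼 4 → 𝔼 4) = fun w => w + -y₀ := by ext w i; simp [hφ]
  have hφsa : (φ.symm : 𝔼 4 → 𝔼 4) = fun w => w + - -y₀ := by
    ext w i; simp [hφ, Homeomorph.addRight_symm]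
  have hψa : (ψ : 𝔼 2 → 𝔼 2) = fun w => w + -w₀ := by ext w i; simp [hψ]
  have hψsa : (ψ.symm : 𝔼 2 → 𝔼 2) = fun w => w + - -w₀ := by
    ext w i; simp [hψ, Homeomorph.addRight_symm]
  refine ⟨φ, ψ, by simp [hφ], ?_, fun _ _ => by simp [hψ], ?_, ?_, ?_, ?_, fun q _ => ?_⟩
  · rw [hφa]; simp
  · rw [hφa]; exact (contDiff_id.add contDiff_const).contDiffOn
  · rw [hφsa]; exact (contDiff_id.add contDiff_const).contDiffOn
  · rw [hψa]; exact (contDiff_id.add contDiff_const).contDiffOn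
  · rw [hψsa]; exact (contDiff_id.add contDiff_const).contDiffOn
  · have hq : q = (q + -y₀) + t • EuclideanSpace.single (0 : Fin 4) (1 : ℝ) := by
      rw [hy₀]; abel
    have key : foldSigMap s₁ s₂ s₃ q + -w₀ = foldSigMap s₁ s₂ s₃ (q + -y₀) := by
      conv_lhs => rw [hq, foldSigMap_add_smul_single]
      rw [hw₀]; abel
    rw [hψa, hφa]
    simp only
    rw [key, foldSigMap_apply_zero, foldSigMap_apply_one]
    exact ⟨rfl, rfl⟩

/-! ### Fold charts pass through target local diffeomorphisms -/

/-- **Composition with a local diffeomorphism of the target preserves fold charts.**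
[folklore] -/
theorem HasFoldChartSig.comp_localDiffeo {F : 𝔼 4 → 𝔼 2} {y : 𝔼 4} {s₁ s₂ s₃ : ℝ}
    (h : HasFoldChartSig F y s₁ s₂ s₃) (hF : Continuous F) (G : OpenPartialHomeomorph (𝔼 2) (𝔼 2))
    (hG : ContDiffOn ℝ ∞ G G.source) (hGs : ContDiffOn ℝ ∞ G.symm G.target) (hy : F y ∈ G.source) :
    HasFoldChartSig (G ∘ F) y s₁ s₂ s₃ := by
  obtain ⟨φ, ψ, hyφ, hy0, hmaps, hφ, hφs, hψ, hψs, hid⟩ := h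
  have hSo : IsOpen (F ⁻¹' G.source) := G.open_source.preimage hF
  set φ' := φ.restrOpen (F ⁻¹' G.source) hSo with hφ'
  have hsrc : φ'.source = φ.source ∩ F ⁻¹' G.source :=
    OpenPartialHomeomorph.restrOpen_source φ _ hSo
  have htgt : φ'.target ⊆ φ.target := fun z hz => hz.1
  refine ⟨φ', G.symm.trans ψ, ?_, hy0, ?_, ?_, hφs.mono htgt, ?_, ?_, ?_⟩
  · rw [hsrc]; exact ⟨hyφ, hy⟩
  · intro q hq
    rw [hsrc] at hq
    rw [OpenPartialHomeomorph.trans_source]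
    refine ⟨G.map_source hq.2, ?_⟩
    show G.symm (G (F q)) ∈ ψ.source
    rw [G.left_inv hq.2]
    exact hmaps hq.1
  · rw [hsrc]; exact hφ.mono inter_subset_left
  · rw [OpenPartialHomeomorph.trans_source, OpenPartialHomeomorph.coe_trans]
    exact hψ.comp (hGs.mono inter_subset_left) fun w hw => hw.2
  · rw [OpenPartialHomeomorph.trans_symm_eq_symm_trans_symm, OpenPartialHomeomorph.trans_target,
      OpenPartialHomeomorph.coe_trans, OpenPartialHomeomorph.symm_symm]
    exact hG.comp (hψs.mono inter_subset_left) fun w hw => hw.2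
  · intro q hq
    rw [hsrc] at hq
    simp only [OpenPartialHomeomorph.coe_trans, Function.comp_apply, G.left_inv hq.2]
    exact hid q hq.1

/-! ### Fold charts of the pushed map along the pushed arc -/

namespace FoldPush

variable {X : Type*} [TopologicalSpace X] [ChartedSpace (𝔼 4) X]
  {B : Type*} [TopologicalSpace B] [ChartedSpace (𝔼 2) B]
  {g : X → B} {φ : OpenPartialHomeomorph X (𝔼 4)} {ψ : OpenPartialHomeomorph B (𝔼 2)}
  {s₁ s₂ s₃ : ℝ} {β₁ : ContDiffBump (0 : ℝ)} {β₂ : ContDiffBump (0 : 𝔼 3)}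

/-- **Fold charts persist along the pushed arc.**  With the data of `exists_pushedMap_spec`
and `sᵢ² = 1`, for `‖θ‖` small the pushed map `g_θ` has a fold chart of signature
`(s₁, s₂, s₃)` (charts of `X` and `B`) at every point `q ∈ φ.source` on the axis
`(φ q)₁ = (φ q)₂ = (φ q)₃ = 0`. [cite: BaykurSaeki2017, §2.1 p. 6, §3] -/
theorem exists_pushedMap_foldCharts
    (hφ : ContMDiffOn (𝓡 4) (𝓡 4) ∞ φ φ.source) (hφs : ContMDiffOn (𝓡 4) (𝓡 4) ∞ φ.symm φ.target)
    (hψ : ContMDiffOn (𝓡 2) (𝓡 2) ∞ ψ ψ.source) (hψs : ContMDiffOn (𝓡 2) (𝓡 2) ∞ ψ.symm ψ.target)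
    (hmaps : MapsTo g φ.source ψ.source)
    (hid : ∀ q ∈ φ.source, ψ (g q) = foldSigMap s₁ s₂ s₃ (φ q))
    (hsq₁ : s₁ ^ 2 = 1) (hsq₂ : s₂ ^ 2 = 1) (hsq₃ : s₃ ^ 2 = 1) (hbox : box β₁ β₂ ⊆ φ.target) :
    ∃ ε > 0, ∀ θ : 𝔼 2, ‖θ‖ < ε → ∀ q ∈ φ.source, φ q 1 = 0 → φ q 2 = 0 → φ q 3 = 0 →
      HasManifoldFoldChart (pushedMap g φ ψ s₁ s₂ s₃ β₁ β₂ θ) q := by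
  obtain ⟨δ, hδ, htarget⟩ := exists_push_margin hmaps hid hbox
  obtain ⟨ε₂, hε₂, hplane⟩ := exists_pushPlane_localInverse β₁
  refine ⟨min δ ε₂, lt_min hδ hε₂, fun θ hθ q hq h1 h2 h3 => ?_⟩
  have hθδ : ‖θ‖ < δ := lt_of_lt_of_le hθ (min_le_left _ _)
  have hθ₂ : ‖θ‖ < ε₂ := lt_of_lt_of_le hθ (min_le_right _ _)
  set P : X → B := pushedMap g φ ψ s₁ s₂ s₃ β₁ β₂ θ with hP
  set y₀ : 𝔼 4 := φ q with hy₀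
  -- `y₀` is the axis point `t e₀`
  have hy₀eq : y₀ = (y₀ 0) • EuclideanSpace.single (0 : Fin 4) (1 : ℝ) := by
    ext i
    fin_cases i
    · simp
    · simpa using h1
    · simpa using h2
    · simpa using h3
  have hfib : ‖fibrePart y₀‖ < β₂.rIn := by
    have : fibrePart y₀ = 0 := by
      ext i
      fin_cases i
      · simpa [fibrePart_apply] using h1
      · simpa [fibrePart_apply] using h2
      · simpa [fibrePart_apply] using h3
    rw [this, norm_zero]
    exact β₂.rIn_pos
  -- the model: fold chart of `F₀` at `y₀`, pushed through the local inverse of `T_θ`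
  have h0 : HasFoldChartSig (foldSigMap s₁ s₂ s₃) y₀ s₁ s₂ s₃ := by
    rw [hy₀eq]
    exact hasFoldChartSig_foldSigMap_axis s₁ s₂ s₃ (y₀ 0)
  obtain ⟨G, hGT, hw₀, hGs, hGss⟩ := hplane θ hθ₂ (foldSigMap s₁ s₂ s₃ y₀)
  have h1' : HasFoldChartSig (G ∘ foldSigMap s₁ s₂ s₃) y₀ s₁ s₂ s₃ :=
    h0.comp_localDiffeo (contDiff_foldSigMap s₁ s₂ s₃).continuous G hGs hGss hw₀
  have h2' : HasFoldChartSig (foldPushMap s₁ s₂ s₃ β₁ β₂ θ) y₀ s₁ s₂ s₃ := by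
    refine h1'.congr_of_eventuallyEq ?_
    have hnear := foldPushMap_eventuallyEq_near_axis (s₁ := s₁) (s₂ := s₂) (s₃ := s₃)
      (β₁ := β₁) hfib θ
    filter_upwards [hnear] with z hz
    rw [hz, Function.comp_apply, Function.comp_apply, hGT]
  -- the representative `ψ ∘ P ∘ φ⁻¹ = F_θ` near `y₀`
  have h3' : HasFoldChartSig (ψ ∘ P ∘ φ.symm) (φ q) s₁ s₂ s₃ := by
    refine h2'.congr_of_eventuallyEq ?_
    filter_upwards [φ.open_target.mem_nhds (φ.map_source hq)] with z hz
    exact (apply_pushedMap_symm (g := g) (htarget θ hθδ) hz).symm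
  have hPmaps : MapsTo P φ.source ψ.source := fun q' hq' =>
    (apply_pushedMap_of_mem (g := g) (htarget θ hθδ) hq').1
  obtain ⟨φ', ψ', c1, c2, c3, c4, c5, c6, c7, c8⟩ :=
    exists_foldChartSig_of_hasFoldChartSig hφ hφs hψ hψs hPmaps hq h3'
  exact ⟨s₁, s₂, s₃, φ', ψ', hsq₁, hsq₂, hsq₃, c1, c2, c3, c4, c5, c6, c7, c8⟩

end FoldPush

end Literature.Topology.FourManifolds
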